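import Literature.NumberTheory.LFunctions.ConreyAuxiliaryQ
import Literature.NumberTheory.LFunctions.RiemannSiegelUniformBounds
import Literature.NumberTheory.LFunctions.RiemannSiegelChiBounds
import Literature.Analysis.Complex.VerticalArgVariation
import Literature.Analysis.Complex.BacklundArgVariation
import Mathlib.Analysis.Complex.Liouville
import HarnessLib

/-!
# Conrey's `V` on the right edge `σ = 5/2`: `V → 𝜙(0)` and `|Δ arg V| ≤ π`

Topic `Literature/NumberTheory/LFunctions`. Everything here is PROVED; there are no definitions
and no named facts.

In Levinson's method as run by Conrey (J. Number Theory 16 (1983), §4 (2)–(3)) the function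
`V = 𝜙(−δ/L)𝓡 + χ · 𝜙(1 − δ/L)K` (`Literature.NumberTheory.LFunctions.conreyV`) is followed around
the rectangle `[½, σ₀] × [T₁, T₂]`; on the right edge one needs `V ≈ 𝜙(0) ≠ 0`, whence
"`|Δ arg V(σ₀ + it)| < π` if `σ₀` is large enough" (loc. cit., before (3)). We take `σ₀ = 5/2`
(inside the strip `0 < σ < 3` of the tree's Riemann–Siegel formula) and prove, for every real
polynomial `𝜙` with `𝜙(0) ≠ 0`:

* `norm_polyDerivOp_le`, `norm_polyDerivOp_sub_coeff_zero_mul_le` — **Cauchy transfer**: bounds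
  for `p(a d/ds)F(s)` and for `p(a d/ds)F(s) − p(0)F(s)` from bounds of `F` (resp. `F − C`) on a
  circle `|w − s| = r` (Cauchy's estimate `‖F⁽ᵏ⁾(s)‖ ≤ k! M/rᵏ`);
* `norm_polyDerivOp_riemannAux_sub_le` — at `s = 5/2 + it`, `t ≥ 400π`, `L ≥ 1`:
  `‖(𝜙(−δ/L)𝓡)(s) − 𝜙(0)‖ ≤ |𝜙(0)| (2/3 + 5·4^{5/2} x₀^{−3/2}) + (2 + 5·4^{7/2}) A₁/L`
  (`x₀ = √(t/2π)`, `A₁ = Σ_{k≥1} |𝜙ₖ| k!`), from the crude Riemann–Siegel bounds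
  `Literature.NumberTheory.LFunctions.SiegelIntegral.norm_riemannAux_sub_one_le`;
* `norm_rsChi_mul_polyDerivOp_riemannAuxConj_le` — the reflected term is
  `≤ (6π²/t²) · A₂ · 6·4^{5/2} (x₀ + 1)^{7/2}` (`A₂ = Σ |𝜙̃ₖ| k!`, `𝜙̃ = 𝜙∘(1−X)`), i.e.
  `O(t^{−1/4})`, from `‖χ(5/2+it)‖ ≤ 6π²/t²`
  (`Literature.NumberTheory.LFunctions.SiegelIntegral.norm_rsChi_five_halves_le`) and the polynomial
  growth of `𝓡` in `−5/2 ≤ σ ≤ −1/2`;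
* `conreyV_rightEdge` — **there are `L₀ ≥ 1`, `T₀ > 0` with
  `‖V(5/2 + it) − 𝜙(0)‖ ≤ (5/6)|𝜙(0)|` for all `L ≥ L₀`, `t ≥ T₀`**;
* `re_mul_conreyV_pos_of_norm_sub_le`, `norm_conreyV_ge_of_norm_sub_le` — hence
  `Re(𝜙(0)·V) > 0` and `|V| ≥ |𝜙(0)|/6` there;
* `conreyV_rightEdge_argVariation` — and, by
  `Literature.Analysis.Complex.abs_integral_re_logDeriv_vertical_le_pi_of_re_nonneg`,
  **`|∫_{T₁}^{T₂} Re (V'/V)(5/2 + iy) dy| ≤ π`** for `T₀ ≤ T₁ ≤ T₂` — the right-edge term of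
  `Literature.NumberTheory.LFunctions.levinsonConrey_criticalZeroCount_ge` with `b = 5/2`.

## References

* J. B. Conrey, *Zeros of derivatives of Riemann's ξ-function on the critical line*, J. Number
  Theory 16 (1983), 49–74, §4 (2)–(3). [Conrey1983]
* E. C. Titchmarsh, *The Theory of the Riemann Zeta-Function*, 2nd ed. (1986), §4.16, §9.4,
  §10.28. [Titchmarsh1986]
-/

noncomputable section

open Complex Polynomial Set Filter Topology Metric MeasureTheory
open scoped Real ComplexConjugate

namespace Literature.NumberTheory.LFunctions

open Literature.Analysis.Complex SiegelIntegral

/-! ### Cauchy transfer for `polyDerivOp` -/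

/-- Cauchy's estimate for `k ≥ 1` from a bound of `F − C` on the circle `|w − s| = r`:
`‖F⁽ᵏ⁾(s)‖ ≤ k! M / rᵏ`. [folklore] -/
theorem norm_iteratedDeriv_le_of_sub_const {F : ℂ → ℂ} (hF : Differentiable ℂ F) {s : ℂ} {r M : ℝ}
    (hr : 0 < r) (C : ℂ) (hM : ∀ w ∈ sphere s r, ‖F w - C‖ ≤ M) {k : ℕ} (hk : k ≠ 0) :
    ‖iteratedDeriv k F s‖ ≤ (k.factorial : ℝ) * M / r ^ k := by
  have hG : Differentiable ℂ (fun w ↦ -C + F w) := (differentiable_const _).add hF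
  have h := Complex.norm_iteratedDeriv_le_of_forall_mem_sphere_norm_le (f := fun w ↦ -C + F w)
    (c := s) k hr hG.diffContOnCl (fun w hw ↦ by rw [neg_add_eq_sub]; exact hM w hw)
  rwa [iteratedDeriv_const_add (Nat.pos_of_ne_zero hk)] at h

/-- **Cauchy transfer for `p(a d/ds)`**: if `‖F‖ ≤ M` on the circle `|w − s| = r` (`F` entire), then
`‖(p(a d/ds)F)(s)‖ ≤ (Σₖ |pₖ| |a|ᵏ k!/rᵏ) · M`. [folklore] -/
theorem norm_polyDerivOp_le (p : ℝ[X]) (a : ℝ) {F : ℂ → ℂ} (hF : Differentiable ℂ F) {s : ℂ}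
    {r M : ℝ} (hr : 0 < r) (hM : ∀ w ∈ sphere s r, ‖F w‖ ≤ M) :
    ‖polyDerivOp p a F s‖ ≤ (∑ k ∈ p.support, |p.coeff k| * |a| ^ k * (k.factorial : ℝ) / r ^ k) * M := by
  rw [polyDerivOp_def, Finset.sum_mul]
  refine (norm_sum_le _ _).trans (Finset.sum_le_sum fun k _ ↦ ?_)
  rw [norm_mul, norm_mul, norm_pow, Complex.norm_real, Complex.norm_real, Real.norm_eq_abs,
    Real.norm_eq_abs]
  have h := Complex.norm_iteratedDeriv_le_of_forall_mem_sphere_norm_le (f := F) (c := s) k hr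
    hF.diffContOnCl hM
  have h0 : 0 ≤ |p.coeff k| * |a| ^ k := by positivity
  calc |p.coeff k| * |a| ^ k * ‖iteratedDeriv k F s‖ ≤ |p.coeff k| * |a| ^ k * ((k.factorial : ℝ) * M / r ^ k) :=
        mul_le_mul_of_nonneg_left h h0
    _ = |p.coeff k| * |a| ^ k * (k.factorial : ℝ) / r ^ k * M := by simp only [div_eq_mul_inv]; ring

/-- `p(a d/ds)F(s) − p(0)F(s) = Σ_{k ≠ 0} pₖ aᵏ F⁽ᵏ⁾(s)`. [folklore] -/
theorem polyDerivOp_sub_coeff_zero_mul (p : ℝ[X]) (a : ℝ) (F : ℂ → ℂ) (s : ℂ) :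
    polyDerivOp p a F s - (p.coeff 0 : ℂ) * F s =
      ∑ k ∈ p.support.erase 0, (p.coeff k : ℂ) * (a : ℂ) ^ k * iteratedDeriv k F s := by
  rw [polyDerivOp_def]
  by_cases h0 : (0 : ℕ) ∈ p.support
  · rw [← Finset.sum_erase_add _ _ h0]
    simp [iteratedDeriv_zero]
  · have hc : p.coeff 0 = 0 := by simpa [Polynomial.mem_support_iff] using h0
    rw [Finset.sum_erase _ (by rw [hc]; simp), hc]
    simp

/-- **Cauchy transfer, constant term removed**: if `‖F − C‖ ≤ M` on the circle `|w − s| = r`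
(`F` entire, `C` any constant), then
`‖(p(a d/ds)F)(s) − p(0)F(s)‖ ≤ (Σ_{k ≠ 0} |pₖ| |a|ᵏ k!/rᵏ) · M`. [folklore] -/
theorem norm_polyDerivOp_sub_coeff_zero_mul_le (p : ℝ[X]) (a : ℝ) {F : ℂ → ℂ}
    (hF : Differentiable ℂ F) {s : ℂ} {r M : ℝ} (hr : 0 < r) (C : ℂ)
    (hM : ∀ w ∈ sphere s r, ‖F w - C‖ ≤ M) :
    ‖polyDerivOp p a F s - (p.coeff 0 : ℂ) * F s‖ ≤
      (∑ k ∈ p.support.erase 0, |p.coeff k| * |a| ^ k * (k.factorial : ℝ) / r ^ k) * M := by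
  rw [polyDerivOp_sub_coeff_zero_mul, Finset.sum_mul]
  refine (norm_sum_le _ _).trans (Finset.sum_le_sum fun k hk ↦ ?_)
  have hk0 : k ≠ 0 := Finset.ne_of_mem_erase hk
  rw [norm_mul, norm_mul, norm_pow, Complex.norm_real, Complex.norm_real, Real.norm_eq_abs,
    Real.norm_eq_abs]
  have h := norm_iteratedDeriv_le_of_sub_const hF hr C hM hk0
  have h0 : 0 ≤ |p.coeff k| * |a| ^ k := by positivity
  calc |p.coeff k| * |a| ^ k * ‖iteratedDeriv k F s‖ ≤ |p.coeff k| * |a| ^ k * ((k.factorial : ℝ) * M / r ^ k) :=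
        mul_le_mul_of_nonneg_left h h0
    _ = |p.coeff k| * |a| ^ k * (k.factorial : ℝ) / r ^ k * M := by simp only [div_eq_mul_inv]; ring

/-! ### The coefficient sums for `a = ∓L⁻¹`, `r = 1`, `L ≥ 1` -/

/-- For `L ≥ 1`: `Σ_{k ≠ 0} |pₖ| |−L⁻¹|ᵏ k!/1ᵏ ≤ (Σ_{k ≠ 0} |pₖ| k!)/L`. [folklore] -/
theorem sum_erase_coeff_inv_le (p : ℝ[X]) {L : ℝ} (hL : 1 ≤ L) :
    ∑ k ∈ p.support.erase 0, |p.coeff k| * |(-L⁻¹)| ^ k * (k.factorial : ℝ) / (1 : ℝ) ^ k ≤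
      (∑ k ∈ p.support.erase 0, |p.coeff k| * (k.factorial : ℝ)) / L := by
  rw [Finset.sum_div]
  refine Finset.sum_le_sum fun k hk ↦ ?_
  have hk0 : k ≠ 0 := Finset.ne_of_mem_erase hk
  have hL0 : 0 < L := by linarith
  rw [one_pow, div_one, abs_neg, abs_of_pos (inv_pos.2 hL0)]
  have hpow : (L⁻¹) ^ k ≤ L⁻¹ := by
    calc (L⁻¹) ^ k ≤ (L⁻¹) ^ 1 := pow_le_pow_of_le_one (inv_nonneg.2 hL0.le)
          (inv_le_one_of_one_le₀ hL) (Nat.one_le_iff_ne_zero.2 hk0)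
      _ = L⁻¹ := pow_one _
  calc |p.coeff k| * (L⁻¹) ^ k * (k.factorial : ℝ) = (|p.coeff k| * (k.factorial : ℝ)) * (L⁻¹) ^ k := by ring
    _ ≤ (|p.coeff k| * (k.factorial : ℝ)) * L⁻¹ := mul_le_mul_of_nonneg_left hpow (by positivity)
    _ = |p.coeff k| * (k.factorial : ℝ) / L := by rw [div_eq_mul_inv]

/-- For `L ≥ 1`: `Σ |pₖ| |L⁻¹|ᵏ k!/1ᵏ ≤ Σ |pₖ| k!`. [folklore] -/
theorem sum_coeff_inv_le (p : ℝ[X]) {L : ℝ} (hL : 1 ≤ L) :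
    ∑ k ∈ p.support, |p.coeff k| * |L⁻¹| ^ k * (k.factorial : ℝ) / (1 : ℝ) ^ k ≤
      ∑ k ∈ p.support, |p.coeff k| * (k.factorial : ℝ) := by
  refine Finset.sum_le_sum fun k _ ↦ ?_
  have hL0 : 0 < L := by linarith
  rw [one_pow, div_one, abs_of_pos (inv_pos.2 hL0)]
  have hpow : (L⁻¹) ^ k ≤ 1 := pow_le_one₀ (inv_nonneg.2 hL0.le) (inv_le_one_of_one_le₀ hL)
  calc |p.coeff k| * (L⁻¹) ^ k * (k.factorial : ℝ) = (|p.coeff k| * (k.factorial : ℝ)) * (L⁻¹) ^ k := by ring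
    _ ≤ (|p.coeff k| * (k.factorial : ℝ)) * 1 := mul_le_mul_of_nonneg_left hpow (by positivity)
    _ = |p.coeff k| * (k.factorial : ℝ) := mul_one _

/-! ### Pointwise bounds at `s = 5/2 + it` -/

/-- `x₀ = √(t/2π) ≥ 14` for `t ≥ 392π`. [folklore] -/
theorem fourteen_le_sqrt {t : ℝ} (ht : 392 * π ≤ t) : 14 ≤ Real.sqrt (t / (2 * π)) := by
  have hπ := Real.pi_pos
  have ht0 : 0 ≤ t := by nlinarith
  rw [Real.le_sqrt (by norm_num) (by positivity), le_div_iff₀ (by positivity)]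
  nlinarith

/-- A point of the circle `|w − (5/2 + it)| = 1` has `3/2 ≤ Re w ≤ 7/2` and `t − 1 ≤ Im w ≤ t + 1`.
[folklore] -/
theorem re_im_of_mem_sphere {t : ℝ} {w : ℂ} (hw : w ∈ sphere (((5 / 2 : ℝ) : ℂ) + t * I) 1) :
    3 / 2 ≤ w.re ∧ w.re ≤ 7 / 2 ∧ t - 1 ≤ w.im ∧ w.im ≤ t + 1 := by
  rw [mem_sphere_iff_norm] at hw
  have hre := Complex.abs_re_le_norm (w - (((5 / 2 : ℝ) : ℂ) + t * I))
  have him := Complex.abs_im_le_norm (w - (((5 / 2 : ℝ) : ℂ) + t * I))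
  rw [hw] at hre him
  simp only [sub_re, add_re, ofReal_re, mul_re, I_re, mul_zero, ofReal_im, I_im, mul_one,
    sub_self, add_zero, sub_im, add_im, mul_im, zero_add] at hre him
  obtain ⟨h1, h2⟩ := abs_le.1 hre
  obtain ⟨h3, h4⟩ := abs_le.1 him
  exact ⟨by linarith, by linarith, by linarith, by linarith⟩

/-- **On the circle `|w − (5/2+it)| = 1`, `t ≥ 400π`: `‖𝓡(w) − 1‖ ≤ 2 + 5 · 4^{7/2}`** (crude;
`Literature.NumberTheory.LFunctions.SiegelIntegral.norm_riemannAux_sub_one_le` with `3/2 ≤ Re w ≤ 7/2`).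
[cite: Titchmarsh1986, §4.16] -/
theorem norm_riemannAux_sub_one_le_of_mem_sphere {t : ℝ} (ht : 400 * π ≤ t) {w : ℂ}
    (hw : w ∈ sphere (((5 / 2 : ℝ) : ℂ) + t * I) 1) :
    ‖riemannAux w - 1‖ ≤ 2 + 5 * (4 : ℝ) ^ (7 / 2 : ℝ) := by
  have hπ := Real.pi_pos
  obtain ⟨h1, h2, h3, _⟩ := re_im_of_mem_sphere hw
  have him : 392 * π ≤ w.im := by nlinarith [Real.pi_gt_three]
  have h14 := fourteen_le_sqrt him
  have h := norm_riemannAux_sub_one_le (σ := w.re) (A := 7 / 2) (t := w.im) h1 h2 (by nlinarith)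
    (by linarith)
  rw [Complex.re_add_im] at h
  refine h.trans (add_le_add ?_ ?_)
  · rw [div_le_iff₀ (by linarith)]; linarith
  · have hx : Real.sqrt (w.im / (2 * π)) ^ (-(3 / 2 : ℝ)) ≤ 1 :=
      Real.rpow_le_one_of_one_le_of_nonpos (by linarith) (by norm_num)
    have h0 : 0 ≤ 5 * (4 : ℝ) ^ (7 / 2 : ℝ) := by positivity
    calc 5 * (4 : ℝ) ^ (7 / 2 : ℝ) * Real.sqrt (w.im / (2 * π)) ^ (-(3 / 2 : ℝ))
        ≤ 5 * (4 : ℝ) ^ (7 / 2 : ℝ) * 1 := mul_le_mul_of_nonneg_left hx h0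
      _ = 5 * (4 : ℝ) ^ (7 / 2 : ℝ) := mul_one _

/-- **The main term on `σ = 5/2`**: for `t ≥ 400π` and `L ≥ 1`, with `x₀ = √(t/2π)` and
`A₁ = Σ_{k≠0} |𝜙ₖ| k!`,
`‖(𝜙(−δ/L)𝓡)(5/2+it) − 𝜙(0)‖ ≤ |𝜙(0)| (2/3 + 5·4^{5/2} x₀^{−3/2}) + (2 + 5·4^{7/2}) A₁/L`
(the term `k = 0` is `𝜙(0)(𝓡(s) − 1)`; the terms `k ≥ 1` by Cauchy transfer on `|w − s| = 1`).
[cite: Conrey1983, §4 (2)–(3)] -/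
theorem norm_polyDerivOp_riemannAux_sub_le (φ : ℝ[X]) {L t : ℝ} (hL : 1 ≤ L) (ht : 400 * π ≤ t) :
    ‖polyDerivOp φ (-L⁻¹) riemannAux (((5 / 2 : ℝ) : ℂ) + t * I) - (φ.coeff 0 : ℂ)‖ ≤
      |φ.coeff 0| * (2 / 3 + 5 * (4 : ℝ) ^ (5 / 2 : ℝ) * Real.sqrt (t / (2 * π)) ^ (-(3 / 2 : ℝ))) +
        (2 + 5 * (4 : ℝ) ^ (7 / 2 : ℝ)) * (∑ k ∈ φ.support.erase 0, |φ.coeff k| * (k.factorial : ℝ)) / L := by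
  have hπ := Real.pi_pos
  have hπ3 := Real.pi_gt_three
  set s : ℂ := ((5 / 2 : ℝ) : ℂ) + t * I with hs
  set A₁ : ℝ := ∑ k ∈ φ.support.erase 0, |φ.coeff k| * (k.factorial : ℝ) with hA₁
  have hA₁0 : 0 ≤ A₁ := Finset.sum_nonneg fun k _ ↦ by positivity
  -- `k = 0`: `‖𝓡(s) - 1‖`
  have h14 : 14 ≤ Real.sqrt (t / (2 * π)) := fourteen_le_sqrt (by linarith)
  have hR := norm_riemannAux_sub_one_le (σ := 5 / 2) (A := 5 / 2) (t := t) (by norm_num) le_rfl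
    (by linarith) (by linarith)
  have hR' : ‖riemannAux s - 1‖ ≤ 2 / 3 + 5 * (4 : ℝ) ^ (5 / 2 : ℝ) * Real.sqrt (t / (2 * π)) ^ (-(3 / 2 : ℝ)) := by
    have e : ((5 / 2 : ℝ) : ℂ) + t * I = s := rfl
    rw [e] at hR
    convert hR using 2; norm_num
  -- `k ≥ 1`: Cauchy transfer on the unit circle
  have hC := norm_polyDerivOp_sub_coeff_zero_mul_le φ (-L⁻¹) differentiable_riemannAux (s := s)
    one_pos 1 (fun w hw ↦ norm_riemannAux_sub_one_le_of_mem_sphere ht hw)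
  have hB := sum_erase_coeff_inv_le φ hL
  have hM0 : 0 ≤ 2 + 5 * (4 : ℝ) ^ (7 / 2 : ℝ) := by positivity
  have hC' : ‖polyDerivOp φ (-L⁻¹) riemannAux s - (φ.coeff 0 : ℂ) * riemannAux s‖ ≤
      (2 + 5 * (4 : ℝ) ^ (7 / 2 : ℝ)) * A₁ / L := by
    refine hC.trans ?_
    exact (mul_le_mul_of_nonneg_right hB hM0).trans (le_of_eq (by ring))
  -- combine
  have hsplit : polyDerivOp φ (-L⁻¹) riemannAux s - (φ.coeff 0 : ℂ) =
      (polyDerivOp φ (-L⁻¹) riemannAux s - (φ.coeff 0 : ℂ) * riemannAux s) +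
        (φ.coeff 0 : ℂ) * (riemannAux s - 1) := by ring
  rw [hsplit]
  refine (norm_add_le _ _).trans ?_
  rw [norm_mul, Complex.norm_real, Real.norm_eq_abs, add_comm]
  exact add_le_add (mul_le_mul_of_nonneg_left hR' (abs_nonneg _)) hC'

/-- `√((t+1)/2π) ≤ √(t/2π) + 1` (`t ≥ 0`). [folklore] -/
theorem sqrt_add_one_div_le {t : ℝ} (ht : 0 ≤ t) :
    Real.sqrt ((t + 1) / (2 * π)) ≤ Real.sqrt (t / (2 * π)) + 1 := by
  have hπ := Real.pi_gt_three
  have hs := Real.sqrt_nonneg (t / (2 * π))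
  rw [Real.sqrt_le_left (by positivity)]
  have hsq : Real.sqrt (t / (2 * π)) ^ 2 = t / (2 * π) := Real.sq_sqrt (by positivity)
  have h1 : (t + 1) / (2 * π) = t / (2 * π) + 1 / (2 * π) := by ring
  have h2 : 1 / (2 * π) ≤ 1 := by rw [div_le_one (by positivity)]; linarith
  nlinarith [hsq]

/-- **The reflected term on `σ = 5/2`**: for `t ≥ 400π` and `L ≥ 1`, with `x₀ = √(t/2π)`,
`𝜙̃ = 𝜙∘(1−X)` and `A₂ = Σ |𝜙̃ₖ| k!`,
`‖χ(s) · (𝜙̃(δ/L)K)(s)‖ ≤ (6π²/t²) · A₂ · 6·4^{5/2} (x₀ + 1)^{7/2}` at `s = 5/2 + it`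
(`K(w) = conj 𝓡(1 − w̄)` with `−5/2 ≤ Re(1 − w̄) ≤ −1/2` on `|w − s| = 1`, where
`‖𝓡‖ ≤ 6·4^{5/2} x₀(Im w)^{7/2}`). [cite: Conrey1983, §4 (2)–(3)] -/
theorem norm_rsChi_mul_polyDerivOp_riemannAuxConj_le (φ : ℝ[X]) {L t : ℝ} (hL : 1 ≤ L)
    (ht : 400 * π ≤ t) :
    ‖rsChi (((5 / 2 : ℝ) : ℂ) + t * I) *
        polyDerivOp (φ.comp (1 - X)) L⁻¹ riemannAuxConj (((5 / 2 : ℝ) : ℂ) + t * I)‖ ≤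
      6 * π ^ 2 / t ^ 2 * (∑ k ∈ (φ.comp (1 - X)).support, |(φ.comp (1 - X)).coeff k| * (k.factorial : ℝ)) *
        (6 * (4 : ℝ) ^ (5 / 2 : ℝ) * (Real.sqrt (t / (2 * π)) + 1) ^ (7 / 2 : ℝ)) := by
  have hπ := Real.pi_pos
  have hπ3 := Real.pi_gt_three
  have ht1 : 1 ≤ t := by nlinarith
  set s : ℂ := ((5 / 2 : ℝ) : ℂ) + t * I with hs
  set ψ : ℝ[X] := φ.comp (1 - X) with hψ
  set A₂ : ℝ := ∑ k ∈ ψ.support, |ψ.coeff k| * (k.factorial : ℝ) with hA₂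
  have hA₂0 : 0 ≤ A₂ := Finset.sum_nonneg fun k _ ↦ by positivity
  set x₀ : ℝ := Real.sqrt (t / (2 * π)) with hx₀
  have hx₀0 : 0 ≤ x₀ := Real.sqrt_nonneg _
  set M : ℝ := 6 * (4 : ℝ) ^ (5 / 2 : ℝ) * (x₀ + 1) ^ (7 / 2 : ℝ) with hM
  -- `χ`
  have hχ : ‖rsChi s‖ ≤ 6 * π ^ 2 / t ^ 2 := by
    have e : s = 5 / 2 + t * I := by rw [hs]; push_cast; ring
    rw [e]; exact norm_rsChi_five_halves_le ht1
  -- `K` on the circle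
  have hK : ∀ w ∈ sphere s 1, ‖riemannAuxConj w‖ ≤ M := by
    intro w hw
    obtain ⟨h1, h2, h3, h4⟩ := re_im_of_mem_sphere hw
    rw [riemannAuxConj, Complex.norm_conj]
    have e : 1 - conj w = ((1 - w.re : ℝ) : ℂ) + w.im * I := by
      apply Complex.ext <;> simp
    rw [e]
    have him : 392 * π ≤ w.im := by nlinarith
    have h14 := fourteen_le_sqrt him
    have h := norm_riemannAux_le_rpow (σ := 1 - w.re) (A := 5 / 2) (t := w.im)
      (abs_le.2 ⟨by linarith, by linarith⟩) (by nlinarith) (by linarith)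
    refine h.trans ?_
    have hmono : Real.sqrt (w.im / (2 * π)) ≤ x₀ + 1 := by
      calc Real.sqrt (w.im / (2 * π)) ≤ Real.sqrt ((t + 1) / (2 * π)) :=
            Real.sqrt_le_sqrt (div_le_div_of_nonneg_right h4 (by positivity))
        _ ≤ x₀ + 1 := sqrt_add_one_div_le (by linarith)
    have h0 : 0 ≤ 6 * (4 : ℝ) ^ (5 / 2 : ℝ) := by positivity
    rw [hM, show (1 : ℝ) + 5 / 2 = 7 / 2 by norm_num]
    exact mul_le_mul_of_nonneg_left (Real.rpow_le_rpow (Real.sqrt_nonneg _) hmono (by norm_num)) h0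
  -- Cauchy transfer
  have hD := norm_polyDerivOp_le ψ L⁻¹ differentiable_riemannAuxConj (s := s) one_pos hK
  have hB := sum_coeff_inv_le ψ hL
  have hM0 : 0 ≤ M := by positivity
  have hD' : ‖polyDerivOp ψ L⁻¹ riemannAuxConj s‖ ≤ A₂ * M :=
    hD.trans (mul_le_mul_of_nonneg_right hB hM0)
  rw [norm_mul]
  calc ‖rsChi s‖ * ‖polyDerivOp ψ L⁻¹ riemannAuxConj s‖ ≤ 6 * π ^ 2 / t ^ 2 * (A₂ * M) :=
        mul_le_mul hχ hD' (norm_nonneg _) (by positivity)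
    _ = 6 * π ^ 2 / t ^ 2 * A₂ * M := by ring

/-! ### `V(5/2 + it) → 𝜙(0)`: the right-edge theorem -/

/-- **Conrey's `V` on the right edge** (J. Number Theory 16 (1983), §4, before (3): `σ₀` "large
enough" replaced by `σ₀ = 5/2` and `L`, `t` large): for a real polynomial `𝜙` with `𝜙(0) ≠ 0` there
are `L₀ ≥ 1` and `T₀ > 0` such that `‖V(5/2 + it) − 𝜙(0)‖ ≤ (5/6)|𝜙(0)|` for all `L ≥ L₀` and
`t ≥ T₀` (`V = conreyV 𝜙 L`). [cite: Conrey1983, §4 (3)] -/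
theorem conreyV_rightEdge (φ : ℝ[X]) (hφ : φ.coeff 0 ≠ 0) :
    ∃ L₀ T₀ : ℝ, 1 ≤ L₀ ∧ 0 < T₀ ∧ ∀ L : ℝ, L₀ ≤ L → ∀ t : ℝ, T₀ ≤ t →
      ‖conreyV φ L (((5 / 2 : ℝ) : ℂ) + t * I) - (φ.coeff 0 : ℂ)‖ ≤ 5 / 6 * |φ.coeff 0| := by
  have hπ := Real.pi_pos
  have hπ3 := Real.pi_gt_three
  set c : ℝ := φ.coeff 0 with hc
  have hc0 : 0 < |c| := abs_pos.2 hφ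
  set A₁ : ℝ := ∑ k ∈ φ.support.erase 0, |φ.coeff k| * (k.factorial : ℝ) with hA₁
  set ψ : ℝ[X] := φ.comp (1 - X) with hψ
  set A₂ : ℝ := ∑ k ∈ ψ.support, |ψ.coeff k| * (k.factorial : ℝ) with hA₂
  have hA₁0 : 0 ≤ A₁ := Finset.sum_nonneg fun k _ ↦ by positivity
  have hA₂0 : 0 ≤ A₂ := Finset.sum_nonneg fun k _ ↦ by positivity
  set M₁ : ℝ := 2 + 5 * (4 : ℝ) ^ (7 / 2 : ℝ) with hM₁
  have hM₁0 : 0 < M₁ := by positivity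
  -- the choice of `L₀`: `M₁ A₁ / L ≤ |c|/24`
  set L₀ : ℝ := max 1 (24 * M₁ * A₁ / |c|) with hL₀
  -- the `t`-dependent error: `K₁ x₀^{-3/2} + K₂ x₀^{-1/2}` with `x₀ = √(t/2π) → ∞`
  set K₁ : ℝ := |c| * (5 * (4 : ℝ) ^ (5 / 2 : ℝ)) with hK₁
  set K₂ : ℝ := 6 * π ^ 2 * A₂ * (6 * (4 : ℝ) ^ (5 / 2 : ℝ)) * (2 : ℝ) ^ (7 / 2 : ℝ) / (2 * π) ^ 2 with hK₂
  have hx₀t : Tendsto (fun t : ℝ ↦ Real.sqrt (t / (2 * π))) atTop atTop :=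
    Real.tendsto_sqrt_atTop.comp (tendsto_id.atTop_div_const (by positivity))
  have hlim : Tendsto (fun x : ℝ ↦ K₁ * x ^ (-(3 / 2 : ℝ)) + K₂ * x ^ (-(1 / 2 : ℝ))) atTop (𝓝 0) := by
    have h1 := (tendsto_rpow_neg_atTop (by norm_num : (0 : ℝ) < 3 / 2)).const_mul K₁
    have h2 := (tendsto_rpow_neg_atTop (by norm_num : (0 : ℝ) < 1 / 2)).const_mul K₂
    simpa using h1.add h2
  have hev : ∀ᶠ t : ℝ in atTop,
      K₁ * Real.sqrt (t / (2 * π)) ^ (-(3 / 2 : ℝ)) + K₂ * Real.sqrt (t / (2 * π)) ^ (-(1 / 2 : ℝ)) <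
        |c| / 12 :=
    (hlim.comp hx₀t).eventually_lt_const (by positivity)
  obtain ⟨T₀, hT₀⟩ := Filter.eventually_atTop.1 (hev.and (Filter.eventually_ge_atTop (400 * π)))
  have hT₀pos : 0 < T₀ := by
    have := (hT₀ T₀ le_rfl).2; nlinarith
  refine ⟨L₀, T₀, le_max_left _ _, hT₀pos, fun L hL t ht ↦ ?_⟩
  obtain ⟨hsmall, ht400⟩ := hT₀ t ht
  have hL1 : 1 ≤ L := le_trans (le_max_left _ _) hL
  have hL0 : 0 < L := by linarith
  have ht1 : 1 ≤ t := by nlinarith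
  set s : ℂ := ((5 / 2 : ℝ) : ℂ) + t * I with hs
  set x₀ : ℝ := Real.sqrt (t / (2 * π)) with hx₀
  have h14 : 14 ≤ x₀ := fourteen_le_sqrt (by linarith)
  have hx₀0 : 0 < x₀ := by linarith
  -- the two pieces
  have hP := norm_polyDerivOp_riemannAux_sub_le φ hL1 ht400
  have hD := norm_rsChi_mul_polyDerivOp_riemannAuxConj_le φ hL1 ht400
  -- `M₁ A₁ / L ≤ |c| / 24`
  have hLterm : M₁ * A₁ / L ≤ |c| / 24 := by
    have h2 : 24 * M₁ * A₁ / |c| ≤ L := le_trans (le_max_right _ _) hL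
    rw [div_le_iff₀ hc0] at h2
    rw [div_le_div_iff₀ hL0 (by norm_num : (0 : ℝ) < 24)]
    calc M₁ * A₁ * 24 = 24 * M₁ * A₁ := by ring
      _ ≤ L * |c| := h2
      _ = |c| * L := mul_comm _ _
  -- the reflected term is `≤ K₂ x₀^{-1/2}`: `t² = (2π)² x₀⁴`, `(x₀+1)^{7/2} ≤ (2x₀)^{7/2}`
  have htx : t = 2 * π * x₀ ^ 2 := by
    have e : 2 * π * (t / (2 * π)) = t := by field_simp
    rw [hx₀, Real.sq_sqrt (by positivity), e]
  have hDterm : 6 * π ^ 2 / t ^ 2 * A₂ * (6 * (4 : ℝ) ^ (5 / 2 : ℝ) * (x₀ + 1) ^ (7 / 2 : ℝ)) ≤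
      K₂ * x₀ ^ (-(1 / 2 : ℝ)) := by
    have h1 : (x₀ + 1) ^ (7 / 2 : ℝ) ≤ (2 : ℝ) ^ (7 / 2 : ℝ) * x₀ ^ (7 / 2 : ℝ) := by
      rw [← Real.mul_rpow (by norm_num) hx₀0.le]
      exact Real.rpow_le_rpow (by linarith) (by linarith) (by norm_num)
    have h2 : t ^ 2 = (2 * π) ^ 2 * x₀ ^ (4 : ℝ) := by
      rw [htx, show (4 : ℝ) = ((4 : ℕ) : ℝ) by norm_num, Real.rpow_natCast]; ring
    have h3 : x₀ ^ (7 / 2 : ℝ) / x₀ ^ (4 : ℝ) = x₀ ^ (-(1 / 2 : ℝ)) := by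
      rw [← Real.rpow_sub hx₀0]; norm_num
    have h0 : 0 ≤ 6 * π ^ 2 * A₂ * (6 * (4 : ℝ) ^ (5 / 2 : ℝ)) := by positivity
    calc 6 * π ^ 2 / t ^ 2 * A₂ * (6 * (4 : ℝ) ^ (5 / 2 : ℝ) * (x₀ + 1) ^ (7 / 2 : ℝ))
        = 6 * π ^ 2 * A₂ * (6 * (4 : ℝ) ^ (5 / 2 : ℝ)) * ((x₀ + 1) ^ (7 / 2 : ℝ) / t ^ 2) := by ring
      _ ≤ 6 * π ^ 2 * A₂ * (6 * (4 : ℝ) ^ (5 / 2 : ℝ)) *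
            ((2 : ℝ) ^ (7 / 2 : ℝ) * x₀ ^ (7 / 2 : ℝ) / t ^ 2) := by
          gcongr
      _ = K₂ * (x₀ ^ (7 / 2 : ℝ) / x₀ ^ (4 : ℝ)) := by
          rw [h2, hK₂]; ring
      _ = K₂ * x₀ ^ (-(1 / 2 : ℝ)) := by rw [h3]
  -- assemble
  have hV : conreyV φ L s - (c : ℂ) =
      (polyDerivOp φ (-L⁻¹) riemannAux s - (c : ℂ)) +
        rsChi s * polyDerivOp ψ L⁻¹ riemannAuxConj s := by
    rw [conreyV]; ring
  rw [hV]
  refine (norm_add_le _ _).trans ?_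
  calc ‖polyDerivOp φ (-L⁻¹) riemannAux s - (c : ℂ)‖ + ‖rsChi s * polyDerivOp ψ L⁻¹ riemannAuxConj s‖
      ≤ (|c| * (2 / 3 + 5 * (4 : ℝ) ^ (5 / 2 : ℝ) * x₀ ^ (-(3 / 2 : ℝ))) + M₁ * A₁ / L) +
          K₂ * x₀ ^ (-(1 / 2 : ℝ)) := add_le_add hP (hD.trans hDterm)
    _ = 2 / 3 * |c| + M₁ * A₁ / L + (K₁ * x₀ ^ (-(3 / 2 : ℝ)) + K₂ * x₀ ^ (-(1 / 2 : ℝ))) := by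
          rw [hK₁]; ring
    _ ≤ 2 / 3 * |c| + |c| / 24 + |c| / 12 := by linarith
    _ ≤ 5 / 6 * |c| := by linarith

/-! ### Consequences: `Re(𝜙(0)V) > 0`, `|V| ≥ |𝜙(0)|/6`, `|Δ arg V| ≤ π` -/

/-- If `‖V − c‖ ≤ (5/6)|c|` (`c = 𝜙(0) ≠ 0` real) then `Re(c·V) ≥ c²/6 > 0`. [folklore] -/
theorem re_mul_conreyV_pos_of_norm_sub_le {φ : ℝ[X]} {L : ℝ} {s : ℂ} (hφ : φ.coeff 0 ≠ 0)
    (h : ‖conreyV φ L s - (φ.coeff 0 : ℂ)‖ ≤ 5 / 6 * |φ.coeff 0|) :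
    0 < ((φ.coeff 0 : ℂ) * conreyV φ L s).re := by
  set c : ℝ := φ.coeff 0
  set V := conreyV φ L s
  have hc2 : 0 < c ^ 2 := lt_of_le_of_ne (sq_nonneg c) (Ne.symm (pow_ne_zero 2 hφ))
  have hre : |(V - c).re| ≤ 5 / 6 * |c| := (Complex.abs_re_le_norm _).trans h
  rw [sub_re, ofReal_re] at hre
  have h1 : ((c : ℂ) * V).re = c * V.re := by simp
  rw [h1]
  have h2 : c * V.re = c ^ 2 + c * (V.re - c) := by ring
  rw [h2]
  have h3 : |c * (V.re - c)| ≤ 5 / 6 * c ^ 2 := by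
    rw [abs_mul]
    calc |c| * |V.re - c| ≤ |c| * (5 / 6 * |c|) := mul_le_mul_of_nonneg_left hre (abs_nonneg _)
      _ = 5 / 6 * c ^ 2 := by rw [← sq_abs]; ring
  linarith [neg_abs_le (c * (V.re - c))]

/-- If `‖V − c‖ ≤ (5/6)|c|` then `|V| ≥ |c|/6`; in particular `V ≠ 0`. [folklore] -/
theorem norm_conreyV_ge_of_norm_sub_le {φ : ℝ[X]} {L : ℝ} {s : ℂ}
    (h : ‖conreyV φ L s - (φ.coeff 0 : ℂ)‖ ≤ 5 / 6 * |φ.coeff 0|) :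
    |φ.coeff 0| / 6 ≤ ‖conreyV φ L s‖ := by
  have h1 : ‖(φ.coeff 0 : ℂ)‖ ≤ ‖conreyV φ L s‖ + ‖conreyV φ L s - (φ.coeff 0 : ℂ)‖ := by
    calc ‖(φ.coeff 0 : ℂ)‖ = ‖conreyV φ L s - (conreyV φ L s - (φ.coeff 0 : ℂ))‖ := by
          rw [sub_sub_cancel]
      _ ≤ ‖conreyV φ L s‖ + ‖conreyV φ L s - (φ.coeff 0 : ℂ)‖ := norm_sub_le _ _
  rw [Complex.norm_real, Real.norm_eq_abs] at h1
  linarith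

/-- **Right-edge package for Levinson's method with `b = 5/2`**: for a real polynomial `𝜙` with
`𝜙(0) ≠ 0` there are `L₀ ≥ 1`, `T₀ > 0` such that for all `L ≥ L₀`:
`V = conreyV 𝜙 L` satisfies `|V(5/2+it)| ≥ |𝜙(0)|/6` (so `V ≠ 0`) for `t ≥ T₀`, and
`|∫_{T₁}^{T₂} Re (V'/V)(5/2 + iy) dy| ≤ π` whenever `T₀ ≤ T₁ ≤ T₂` (Conrey: "`|Δ arg V(σ₀+it)| < π`").
[cite: Conrey1983, §4 (3)] -/
theorem conreyV_rightEdge_argVariation (φ : ℝ[X]) (hφ : φ.coeff 0 ≠ 0) :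
    ∃ L₀ T₀ : ℝ, 1 ≤ L₀ ∧ 0 < T₀ ∧ ∀ L : ℝ, L₀ ≤ L →
      (∀ t : ℝ, T₀ ≤ t → |φ.coeff 0| / 6 ≤ ‖conreyV φ L (((5 / 2 : ℝ) : ℂ) + t * I)‖) ∧
      (∀ t : ℝ, T₀ ≤ t → conreyV φ L (((5 / 2 : ℝ) : ℂ) + t * I) ≠ 0) ∧
      ∀ T₁ T₂ : ℝ, T₀ ≤ T₁ → T₁ ≤ T₂ →
        |∫ y : ℝ in T₁..T₂, (deriv (conreyV φ L) (((5 / 2 : ℝ) : ℂ) + y * I) /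
            conreyV φ L (((5 / 2 : ℝ) : ℂ) + y * I)).re| ≤ π := by
  obtain ⟨L₀, T₀, hL₀, hT₀, h⟩ := conreyV_rightEdge φ hφ
  refine ⟨L₀, T₀, hL₀, hT₀, fun L hL ↦ ⟨fun t ht ↦ norm_conreyV_ge_of_norm_sub_le (h L hL t ht),
    fun t ht h0 ↦ ?_, fun T₁ T₂ hT₁ hT₁₂ ↦ ?_⟩⟩
  · have := norm_conreyV_ge_of_norm_sub_le (h L hL t ht)
    rw [h0, norm_zero] at this
    have := abs_pos.2 hφ
    linarith
  · -- apply the vertical argument-variation bound to `g = 𝜙(0) · V`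
    set c : ℂ := (φ.coeff 0 : ℂ) with hc
    have hc0 : c ≠ 0 := by rw [hc]; exact_mod_cast hφ
    set g : ℂ → ℂ := fun z ↦ c * conreyV φ L z with hg
    have hga : ∀ y ∈ Icc T₁ T₂, AnalyticAt ℂ g ((5 / 2 : ℝ) + y * I) := by
      intro y hy
      have hy0 : 0 < y := lt_of_lt_of_le hT₀ (le_trans hT₁ hy.1)
      refine analyticAt_const.mul (analyticAt_conreyV φ L ?_ ?_ ?_)
      · norm_num
      · norm_num
      · intro h1
        have := congrArg Complex.im h1
        simp at this
        exact hy0.ne' this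
    have hre : ∀ y ∈ Icc T₁ T₂, 0 ≤ (g ((5 / 2 : ℝ) + y * I)).re := fun y hy ↦
      (re_mul_conreyV_pos_of_norm_sub_le hφ (h L hL y (le_trans hT₁ hy.1))).le
    have hg0 : ∀ y ∈ Icc T₁ T₂, g ((5 / 2 : ℝ) + y * I) ≠ 0 := by
      intro y hy h0
      have := re_mul_conreyV_pos_of_norm_sub_le hφ (h L hL y (le_trans hT₁ hy.1))
      have h0' : (φ.coeff 0 : ℂ) * conreyV φ L (((5 / 2 : ℝ) : ℂ) + y * I) = 0 := h0
      rw [h0', zero_re] at this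
      exact lt_irrefl 0 this
    have hmain := abs_integral_re_logDeriv_vertical_le_pi_of_re_nonneg (g := g) (5 / 2 : ℝ) hT₁₂
      hga hg0 hre
    have e : (fun y : ℝ ↦ (deriv g ((5 / 2 : ℝ) + y * I) / g ((5 / 2 : ℝ) + y * I)).re) =
        fun y : ℝ ↦ (deriv (conreyV φ L) (((5 / 2 : ℝ) : ℂ) + y * I) /
          conreyV φ L (((5 / 2 : ℝ) : ℂ) + y * I)).re := by
      funext y
      simp only [hg]
      rw [deriv_const_mul_div_self c hc0]
    rwa [e] at hmain

end Literature.NumberTheory.LFunctions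

end
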